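import Summits.ResolutionOfSingularities.ResolutionOfSingularities.Theorems.EquisingularLiftEquisingularLiftNatNoseTowerBTriplePrimeOfFact
import Summits.ResolutionOfSingularities.ResolutionOfSingularities.Theorems.EquisingularLiftEquisingularLiftNatModelStepChain
import Summits.ResolutionOfSingularities.ResolutionOfSingularities.Theorems.EquisingularLiftEquisingularLiftNatCentreOffGeneric
import Summits.ResolutionOfSingularities.ResolutionOfSingularities.Theorems.EquisingularLiftEquisingularLiftChainRegular
import Summits.ResolutionOfSingularities.ResolutionOfSingularities.Theorems.EquisingularLiftEquisingularLiftCentreBlowupSmooth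
import Literature.AlgebraicGeometry.Resolution.BlowupsExistence
import HarnessLib
import Summits.ResolutionOfSingularities.ResolutionOfSingularities.Theorems.EquisingularLiftEquisingularLiftNatInitialReachResolution
import Summits.ResolutionOfSingularities.ResolutionOfSingularities.Theorems.EquisingularLiftEquisingularLiftNatResidueHypDefs5
import Summits.ResolutionOfSingularities.ResolutionOfSingularities.Theorems.EquisingularLiftEquisingularLiftNatResidueHypDefs

/-!
# [OURS · L1 W4.5(b) · EL♮(3)] THE «UNOBSTRUCTED NOSE FIRST» RUNG (R-ν1) at `n = 3` — `stub_elnat_unobsNoseTowerBTriplePrimeResolutionThree :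
# EmbeddedCurveLiftFact → … → NoseHypUnobsBTriplePrime k 3 H ι → ELNatConclusionO k 3 H ι` — and its HSUB₀ supplier
# `hsub_unobsNoseTowerBTriplePrime_of_fact` (centre from (T-k) AT `𝓔 = ⊥`, then res-L1-w45b-stub-4's stage-generic B‴ nose engine‴)

res-L1-w45b-stub-2 g15 (NOSE WORD v1.1, res-L1-w45b-nose-w2, §1 (H-ν1) / §2 (R-ν1) / §5 «(R-ν1) via a (T-k)-at-⊥ re-cut of stub-2's initial-stage
instance»). OURS; NOT a statement of any manuscript; AI-written, weaker than expert review. No `sorry`; standard axioms; DEF-FREE.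
`--supports stmt-ResolutionOfSingularities-20148 --as helper`.

WHAT. In the engine context of K5′/K5⁰ (base `q : P ⟶ Spec O`, `Y`, stage predicate `Ch`), at a `Ch`-stage `(X', σ', S')` with model square
`(F₁, j, t)`, `j '' T₁ = S'` and `F₁` REGULAR (the initial stage: `F₁ = ℙ³_k`), the downstairs nose data of (H-ν1) — `Z ⊆ T₁` closed, `T₁ ⊄ Z`,
`Z` infinite, curve clause, `Z̃ := (Z)_red` REGULAR, UNOBSTRUCTED embedded deformations `DirStepUnobs F₁ univ _ Z hZ` (`H¹(Z̃, 𝒩_{Z̃/F₁}) = 0`, Čech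
form), a blow-up `υ : F₂ ⟶ F₁` of `𝓘⟨Z⟩` — and (T-k) `EmbeddedCurveLift O k θ P q` give, for every `(F', γ', T', E', K')` reached from the seed
`(F₂, 𝟙, closure υ⁻¹(T₁ ∖ Z), υ⁻¹ Z, [], [], ∅)` through the B‴ tower closure, a `Ch`-stage with a model square for `F'` and `j₉ '' T' = S₉`.
PROOF (res-L1-w45b-nose-w2's (N1)→(N3)→engine route of the (R-ν2) supplier, run with ZERO point steps): (N1) the centre `C ⊆ X'` is (T-k) at the
stage `X'` and the exceptional datum `𝓔 = ⊥` (`V(⊥) = X'` regular, `O`-flat, proper; model `G := F₁`, `E := univ`, trace clause by `comap_bot` /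
`vanishingIdeal_top` / `nilradical_eq_bot`; «`Ẽ = (F₁)_red` regular along `Z̃`» from `F₁` regular through the isomorphism `(⊥).subschemeι`);
(N3) E1-legality `image_support_subset_not_isGenericPoint_of_chain`; the upstairs blow-up `exists_isBlowup` and the model square of `υ` by
`modelStep_chain`; then res-L1-w45b-stub-4's nose engine‴ `hsub_reachNoseTowerBTriplePrime_of_fact'` (✓ p647499, the `Smooth`-binder-free re-cut
of ✓ p628868). THE RUNG = K5⁰ `target_elnat_of_initialReach` (…NatInitialReachResolution, this seat) at the move `Reach₀ :=` «(H-ν1)'s nose data inside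
`T₁` + a blow-up of `𝓘⟨Z⟩` + the B‴ tower closure, `β = γ' ≫ υ`», its HSUB₀ discharged by the supplier ∘ (T-k) `EmbeddedCurveLiftFact`; the hypothesis is
res-type-027's (N0) `NoseHypUnobsBTriplePrime k 3 H ι` (✓ p648428, …NatResidueHypDefs5) BY NAME — its middle clause «`ℙ³_k` regular along `Z̃`» is not
consumed (implied by `isRegular_projectiveSpace`, which K5⁰ feeds to the supplier). CLOSED MODULO (T-k) only, exactly as every rung since the 19th
registration. [folklore; pure composition]
-/

set_option linter.dupNamespace false -- mandated namespace `Summit.<Summit>.<Problem>` of this single-conjunct summit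
set_option linter.overlappingInstances false -- signatures carry `[IsDomain O] [IsDiscreteValuationRing O]`

noncomputable section

open CategoryTheory CategoryTheory.Limits AlgebraicGeometry TopologicalSpace Topology IsLocalRing
open Literature.AlgebraicGeometry.Resolution
open AlgebraicGeometry.Scheme.IdealSheafData
open Summit.ResolutionOfSingularities.ResolutionOfSingularities.Theses.EquisingularLift.Split
open Summit.ResolutionOfSingularities.ResolutionOfSingularities.Cruxes.EquisingularLift.StrataSplit

namespace Summit.ResolutionOfSingularities.ResolutionOfSingularities.Cruxes.EquisingularLiftNat.Sections

/-- On a REDUCED scheme `G` the reduced closed subscheme on `univ` is all of `G`: its immersion `redSubι G univ _` is an isomorphism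
(`𝓘⟨univ⟩ = nilradical = ⊥`). [folklore] -/
theorem isIso_redSubι_univ (G : Scheme.{0}) [IsReduced G] : IsIso (redSubι G Set.univ isClosed_univ) := by
  have h : vanishingIdeal (⟨Set.univ, isClosed_univ⟩ : Closeds G) = (⊥ : G.IdealSheafData) := by
    rw [show (⟨Set.univ, isClosed_univ⟩ : Closeds G) = ⊤ from rfl, vanishingIdeal_top, Scheme.nilradical_eq_bot]
  change IsIso (vanishingIdeal (⟨Set.univ, isClosed_univ⟩ : Closeds G)).subschemeι
  rw [h]
  infer_instance

/-- Hence, on a reduced scheme `G` that is regular, every stalk of `(univ)_red` is a regular local ring — the clause «`Ẽ` regular along `Z̃`» of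
(T-k) `EmbeddedCurveLiftAt … ⊥` at `E = univ`. [folklore] -/
theorem isRegularLocalRing_stalk_redSub_univ (G : Scheme.{0}) [IsReduced G] (hG : Scheme.IsRegular G)
    (y : ↥(redSub G Set.univ isClosed_univ)) : IsRegularLocalRing ((redSub G Set.univ isClosed_univ).presheaf.stalk y) := by
  haveI := isIso_redSubι_univ G
  haveI := hG (redSubι G Set.univ isClosed_univ y)
  exact IsRegularLocalRing.of_ringEquiv (asIso ((redSubι G Set.univ isClosed_univ).stalkMap y)).commRingCatIsoToRingEquiv

/-- **THE HSUB₀ SUPPLIER OF (R-ν1) at `n = 3`** — see the module docstring. Binders: K5⁰'s engine context, stage and model VERBATIM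
(`…NatInitialReachResolution`), `F₁` regular, then the nose data of (H-ν1) downstairs and a blow-up `υ` of `𝓘⟨Z⟩`; ONE named input (T-k)
`EmbeddedCurveLift O k θ P q`; conclusion = HSUB‴(ReachNoseTowerB‴)₃'s. [folklore; pure composition] [OURS · L1 W4.5b · nose (R-ν1)] -/
theorem hsub_unobsNoseTowerBTriplePrime_of_fact (k : Type) [Field k]
    (O : Type) [CommRing O] [IsDomain O] [IsDiscreteValuationRing O] [IsAdicComplete (IsLocalRing.maximalIdeal O) O]
    [IsAlgClosed (IsLocalRing.ResidueField O)] (θ : O →+* k) (hθ : Function.Surjective θ)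
    (P : Scheme.{0}) (q : P ⟶ Spec (.of O))
    -- (T-k)
    (hFact : EmbeddedCurveLift O k θ P q)
    (Y : Set P) (Ch : ∀ X' : Scheme.{0}, (X' ⟶ P) → Set X' → Prop)
    (hChStep : ∀ (X' X'' : Scheme.{0}) (σ' : X' ⟶ P) (S' : Set X') (C : X'.IdealSheafData) (τ : X'' ⟶ X'),
      Ch X' σ' S' → IsBlowup τ C → Scheme.IsRegular C.subscheme → Flat (C.subschemeι ≫ σ' ≫ q) →
      σ' '' (C.support : Set X') ⊆ {y | ¬ IsGenericPoint y Y} →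
      (C.support : Set X') ∩ (σ' ≫ q) ⁻¹' {IsLocalRing.closedPoint O} ⊆ S' →
      Ch X'' (τ ≫ σ') (closure (τ ⁻¹' (S' \ (C.support : Set X')))))
    (hChSplit : ∀ (X' : Scheme.{0}) (σ' : X' ⟶ P) (S' : Set X'), Ch X' σ' S' → Chain P Y X' σ' S')
    (hYsp : Y ⊆ q ⁻¹' {IsLocalRing.closedPoint O}) (hYirr : IsIrreducible Y) (hYcl : IsClosed Y) (hPint : IsIntegral P)
    (hPnoeth : IsLocallyNoetherian P) (hPreg : Scheme.IsRegular P) (hqprop : IsProper q) (hqsm : SmoothOfRelativeDimension 3 q)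
    -- the stage of the nose and its model (at a rung: the initial stage, `F₁ = ℙ³_k`)
    (X' : Scheme.{0}) (σ' : X' ⟶ P) (S' : Set X') (hCh' : Ch X' σ' S') (hX'int : IsIntegral X') (hX'noeth : IsLocallyNoetherian X')
    (hX'reg : Scheme.IsRegular X') (hX'dom : IsDominant (σ' ≫ q))
    (F₁ : Scheme.{0}) (hF₁ : IsIntegral F₁) (j : F₁ ⟶ X') (t : F₁ ⟶ Spec (.of k))
    (hsq : IsPullback j t (σ' ≫ q) (Spec.map (CommRingCat.ofHom θ)))
    (T₁ : Set F₁) (hT₁cl : IsClosed T₁) (hT₁irr : IsIrreducible T₁) (hjT₁ : j '' T₁ = S') (hF₁reg : Scheme.IsRegular F₁)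
    -- the nose data of (H-ν1) downstairs and the nose blow-up
    (Z : Set F₁) (hZ : IsClosed Z) (hZT₁ : Z ⊆ T₁) (hT₁Z : ¬ (T₁ ⊆ Z)) (hZinf : Z.Infinite)
    (hZdim : ∀ z : ↥(redSub F₁ Z hZ), IsClosed ({z} : Set ↥(redSub F₁ Z hZ)) →
      ringKrullDim ((redSub F₁ Z hZ).presheaf.stalk z) = ((1 : ℕ) : WithBot ℕ∞))
    (hZreg : Scheme.IsRegular (redSub F₁ Z hZ)) (hunobs : DirStepUnobs F₁ Set.univ isClosed_univ Z hZ)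
    (F₂ : Scheme.{0}) (υ : F₂ ⟶ F₁) (hυ : IsBlowup υ (vanishingIdeal (⟨Z, hZ⟩ : Closeds F₁))) :
    -- the conclusion of HSUB‴(ReachNoseTowerB‴)₃
    ∀ (F' : Scheme.{0}) (γ' : F' ⟶ F₂) (T' E' K' : Set F'),
      (∃ Es' Ns' : List (Set F'), ∀ R₁ : (∀ G : Scheme.{0}, (G ⟶ F₂) → Set G → Set G → List (Set G) → List (Set G) → Set G → Prop),
        R₁ F₂ (𝟙 F₂) (closure (υ ⁻¹' (T₁ \ Z))) (υ ⁻¹' Z) [] [] ∅ → TowerPtRegB₄ F₂ R₁ → TowerPtRamB₄ F₂ R₁ →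
        TowerRoundBTriplePrime F₁ F₂ υ Z hZ R₁ → R₁ F' γ' T' E' Es' Ns' K') →
      ∃ (X₉ : Scheme.{0}) (σ₉ : X₉ ⟶ P) (S₉ : Set X₉) (j₉ : F' ⟶ X₉) (t₉ : F' ⟶ Spec (.of k)),
        Ch X₉ σ₉ S₉ ∧ IsIntegral X₉ ∧ IsLocallyNoetherian X₉ ∧ Scheme.IsRegular X₉ ∧ IsDominant (σ₉ ≫ q) ∧
        IsPullback j₉ t₉ (σ₉ ≫ q) (Spec.map (CommRingCat.ofHom θ)) ∧ j₉ '' T' = S₉ ∧ IsClosed T' ∧ IsIrreducible T' ∧ IsIntegral F' := by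
  classical
  haveI := hPint; haveI := hPnoeth; haveI := hX'int; haveI := hX'noeth; haveI := hF₁
  -- properness / flatness of the stage over `O`
  obtain ⟨-, -, hσ'prop⟩ := chain_isRegular P Y X' σ' S' (hChSplit _ _ _ hCh') hPnoeth hPreg
  haveI := hσ'prop
  haveI : IsProper q := hqprop
  haveI : IsDominant (σ' ≫ q) := hX'dom
  have hflat' : Flat (σ' ≫ q) := flat_of_isIntegral_of_isDominant (σ' ≫ q)
  haveI := hflat'
  -- (N1) the centre from (T-k) at `𝓔 = ⊥` on the stage `X'`, model `j : F₁ ⟶ X'`, `E = univ`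
  have hbotreg : Scheme.IsRegular (⊥ : X'.IdealSheafData).subscheme := by
    intro y
    haveI := hX'reg ((⊥ : X'.IdealSheafData).subschemeι y)
    exact IsRegularLocalRing.of_ringEquiv (asIso ((⊥ : X'.IdealSheafData).subschemeι.stalkMap y)).commRingCatIsoToRingEquiv
  have hbotflat : Flat ((⊥ : X'.IdealSheafData).subschemeι ≫ σ' ≫ q) := inferInstance
  have hbotprop : IsProper ((⊥ : X'.IdealSheafData).subschemeι ≫ σ' ≫ q) := inferInstance
  have hGreg : ∀ (i : redSub F₁ Z hZ ⟶ redSub F₁ Set.univ isClosed_univ), i ≫ redSubι F₁ Set.univ isClosed_univ = redSubι F₁ Z hZ →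
      ∀ x : ↥(redSub F₁ Z hZ), IsRegularLocalRing ((redSub F₁ Set.univ isClosed_univ).presheaf.stalk (i x)) :=
    fun i _ x => isRegularLocalRing_stalk_redSub_univ F₁ hF₁reg (i x)
  obtain ⟨C, -, hCreg, hCfl, hCj, -⟩ := hFact X' σ' ⊥ hX'int hX'noeth hX'reg hbotreg hbotflat hbotprop F₁ j t hsq
    Set.univ isClosed_univ
    (by rw [Scheme.IdealSheafData.comap_bot, show (⟨Set.univ, isClosed_univ⟩ : Closeds F₁) = ⊤ from rfl, vanishingIdeal_top,
      Scheme.nilradical_eq_bot])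
    Z hZ (Set.subset_univ Z) hZreg hGreg hunobs
  -- (N3) E1-legality of `C` upstairs: off the generic point of `Y`
  have hoff : σ' '' (C.support : Set X') ⊆ {y : P | ¬ IsGenericPoint y Y} :=
    image_support_subset_not_isGenericPoint_of_chain θ hθ q Y hYsp σ' S' (hChSplit _ _ _ hCh') j t hsq T₁ hjT₁ C Z hZ hCj hT₁Z
  have hCoff : ∀ c ∈ (C.support : Set X'), ¬ IsGenericPoint (σ' c) Y := fun c hc => hoff ⟨c, hc, rfl⟩
  -- the upstairs blow-up of `C` and the model square for the downstairs nose blow-up `υ` (`modelStep_chain`)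
  have hDT : (((vanishingIdeal (⟨Z, hZ⟩ : Closeds F₁)) : F₁.IdealSheafData).support : Set F₁) ⊆ T₁ := by
    rw [Scheme.IdealSheafData.coe_support_vanishingIdeal]; exact hZT₁
  have hTD : ¬ T₁ ⊆ (((vanishingIdeal (⟨Z, hZ⟩ : Closeds F₁)) : F₁.IdealSheafData).support : Set F₁) := by
    rw [Scheme.IdealSheafData.coe_support_vanishingIdeal]; exact hT₁Z
  obtain ⟨X₁, τ₁, hτ₁⟩ := exists_isBlowup X' C
  obtain ⟨hX₁i, hX₁n, hX₁r, hX₁dom, hF₂i, hirr₂, j₂, t₂, hsq₂, hcomm, hCh₁⟩ :=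
    modelStep_chain O k θ hθ P q Y hYirr hYcl Ch hChSplit hChStep X' σ' S' hCh' hX'reg hX'dom F₁ j t hsq T₁ hjT₁
      C (vanishingIdeal (⟨Z, hZ⟩ : Closeds F₁)) hCj hCreg hCfl hoff hDT hTD X₁ τ₁ hτ₁ F₂ υ hυ
  rw [Scheme.IdealSheafData.coe_support_vanishingIdeal] at hirr₂ hCh₁
  have hexc : (C.comap τ₁).comap j₂ = (vanishingIdeal (⟨Z, hZ⟩ : Closeds F₁)).comap υ := by
    rw [← Scheme.IdealSheafData.comap_comp, hcomm, Scheme.IdealSheafData.comap_comp, hCj]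
  -- res-L1-w45b-stub-4's stage-generic nose engine‴ (✓ p628868; `Smooth`-binder-free re-cut ✓ p647499) on the B‴ tail
  exact hsub_reachNoseTowerBTriplePrime_of_fact' k O θ hθ P q Y Ch hChStep hChSplit hYsp hYirr hYcl hPint hPnoeth hPreg hqprop hqsm
    X' σ' S' hCh' hX'int hX'noeth hX'reg hX'dom F₁ hF₁ j t hsq T₁ hT₁cl hT₁irr hjT₁
    Z hZ hZT₁ hT₁Z hZinf hZdim C hCreg hCfl hCj hCoff X₁ τ₁ hτ₁ hX₁i hX₁n hX₁r hX₁dom F₂ hF₂i υ hυ j₂ t₂ hsq₂ hcomm hexc hirr₂ hCh₁ hFact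


/-- **(R-ν1) THE «UNOBSTRUCTED NOSE FIRST» RUNG at `n = 3`** (NOSE WORD v1.1 §2, signature VERBATIM): for `p` prime, `k = k̄` of characteristic `p`,
`ι : H ↪ ℙ³_k` integral with locally principal ideal (`HypLocPrincipal`, unfolded as in (R-ν2) ✓ p649915), (H-ν1) `NoseHypUnobsBTriplePrime k 3 H ι` (✓ p648428) ⇒ `ELNatConclusionO k 3 H ι`, over the
NEED-FACT (T-k) `EmbeddedCurveLiftFact`. Proof = K5⁰ `target_elnat_of_initialReach` ∘ `hsub_unobsNoseTowerBTriplePrime_of_fact` ∘ (T-k); the def's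
middle clause (ambient regular along `Z̃`) is dropped — K5⁰ hands the supplier `F₁ = ℙ³_k` regular. [folklore; pure composition] [OURS · L1 W4.5b · nose (R-ν1)] -/
theorem stub_elnat_unobsNoseTowerBTriplePrimeResolutionThree (p : ℕ) : EmbeddedCurveLiftFact → p.Prime →
    ∀ (k : Type) [Field k] [CharP k p] [IsAlgClosed k] (H : AlgebraicGeometry.Scheme.{0})
    (ι : H ⟶ (Literature.AlgebraicGeometry.Motives.projectiveSpace 3 k).left),
    AlgebraicGeometry.IsClosedImmersion ι → AlgebraicGeometry.IsIntegral H →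
    (∀ y : (Literature.AlgebraicGeometry.Motives.projectiveSpace 3 k).left,
      ∃ U : (Literature.AlgebraicGeometry.Motives.projectiveSpace 3 k).left.affineOpens,
        y ∈ (U : (Literature.AlgebraicGeometry.Motives.projectiveSpace 3 k).left.Opens) ∧ (ι.ker.ideal U).IsPrincipal) →
    NoseHypUnobsBTriplePrime k 3 H ι → ELNatConclusionO k 3 H ι := by
  intro hF hp k _ _ _ H ι hι hH hloc hν
  obtain ⟨Z, hZ, hZreg, -, hunobs, hZsub, hZnsub, hZinf, hZdim, F₂, υ, hυ, F', γ', T', E', Es', Ns', K', htower, hregD⟩ := hν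
  refine target_elnat_of_initialReach p
    (fun F₁ T₁ F' β T' => ∃ (Z : Set F₁) (hZ : IsClosed Z), Z ⊆ T₁ ∧ ¬ (T₁ ⊆ Z) ∧ Z.Infinite ∧
      (∀ z : ↥(redSub F₁ Z hZ), IsClosed ({z} : Set ↥(redSub F₁ Z hZ)) → ringKrullDim ((redSub F₁ Z hZ).presheaf.stalk z) = ((1 : ℕ) : WithBot ℕ∞)) ∧
      Scheme.IsRegular (redSub F₁ Z hZ) ∧ DirStepUnobs F₁ Set.univ isClosed_univ Z hZ ∧
      ∃ (F₂ : Scheme.{0}) (υ : F₂ ⟶ F₁), IsBlowup υ (vanishingIdeal (⟨Z, hZ⟩ : Closeds F₁)) ∧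
        ∃ (γ' : F' ⟶ F₂) (E' : Set F') (Es' Ns' : List (Set F')) (K' : Set F'),
          (∀ R : (∀ G : Scheme.{0}, (G ⟶ F₂) → Set G → Set G → List (Set G) → List (Set G) → Set G → Prop),
            R F₂ (𝟙 F₂) (closure (υ ⁻¹' (T₁ \ Z))) (υ ⁻¹' Z) [] [] ∅ → TowerPtRegB₄ F₂ R → TowerPtRamB₄ F₂ R →
            TowerRoundBTriplePrime F₁ F₂ υ Z hZ R → R F' γ' T' E' Es' Ns' K') ∧
          β = γ' ≫ υ)
    hp k 3 H ι hι hH hloc ?_ ⟨F', γ' ≫ υ, T', ⟨Z, hZ, hZsub, hZnsub, hZinf, hZdim, hZreg, hunobs, F₂, υ, hυ, γ', E', Es', Ns', K', htower, rfl⟩, hregD⟩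
  intro O _ _ _ _ _ θ hθ P q Y Ch hChStep hChSplit hYsp hYirr hYcl hPint hPnoeth hPreg hqprop hqsm X' σ' S' hCh' hX'int hX'noeth hX'reg hX'dom
    F₁ hF₁ j t hsq T₁ hT₁cl hT₁irr hjT₁ hF₁reg G β T₉ hR
  obtain ⟨Z₁, hZ₁, hZT, hTZ, hZinf₁, hZdim₁, hZreg₁, hunobs₁, G₂, υ₁, hυ₁, γ₁, E₁, Es₁, Ns₁, K₁, htower₁, hβ⟩ := hR
  exact hsub_unobsNoseTowerBTriplePrime_of_fact k O θ hθ P q (hF k O θ hθ P q) Y Ch hChStep hChSplit hYsp hYirr hYcl hPint hPnoeth hPreg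
    hqprop hqsm X' σ' S' hCh' hX'int hX'noeth hX'reg hX'dom F₁ hF₁ j t hsq T₁ hT₁cl hT₁irr hjT₁ hF₁reg Z₁ hZ₁ hZT hTZ hZinf₁ hZdim₁ hZreg₁ hunobs₁
    G₂ υ₁ hυ₁ G γ₁ T₉ E₁ K₁ ⟨Es₁, Ns₁, htower₁⟩

end Summit.ResolutionOfSingularities.ResolutionOfSingularities.Cruxes.EquisingularLiftNat.Sections

end
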